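import Mathlib
import Summits.Ventures.HodgeRepro2.T5DVRQuotientModel

/-!
# Cardinalities of the finite quotients `𝒪/(ϖ^n)` of a discrete valuation ring

Blind cell `pub-hodge-repro2`, seat p7 (gen 9), Tier-5 kernel support for N5 / §G [R-4]
(route/T5-LEAN-p7.md §22(b)(iv): the «its quotients finite» half of the DVR / finite-quotient
modelling clause; route/T5-route-3.md §AA.1(b)(iii): `|R| = q^c` and the index
`[𝒪^× : 1 + 𝔭^c] = q^{c−1}(q − 1)`).

For a discrete valuation ring `𝒪` with uniformiser `ϖ` and residue field of cardinality
`q = |𝒪/(ϖ)|`: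

* `card_quot_span_pow`: `|𝒪/(ϖ^n)| = q^n` (Mathlib's `cardQuot_pow_of_prime` on the Dedekind
  domain `𝒪`, transported along `(ϖ)^n = (ϖ^n)`);
* `finite_quot_span_pow` / `finite_quot_span_pow_of_finite_residueField`: a finite residue field
  makes every quotient `𝒪/(ϖ^n)` finite — the `Fintype`/`Finite` hypotheses of the Gauss-sum
  files (`T5LocalRingGaussSum`, `T5KudlaGaussSum`) are met from the residue field alone;
* on the finite local ring `R = 𝒪/(ϖ^{m+1})` (`T5DVRQuotientModel.isLocalRing_quot`): the
  non-units form the ideal `nonunitIdeal = (ϖ)/(ϖ^{m+1})` (`not_isUnit_iff_mem`), of cardinality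
  `q^m` (`card_nonunitIdeal`), and `|Rˣ| = q^m (q − 1)` (`card_units`) — the index
  `[𝒪^× : 1 + 𝔭^{m+1}]` of Kudla's integral over `𝒪^×` in §AA.1(iii).

Nothing about local fields, measures or characters is defined here; the counts are pure
commutative algebra of the DVR.  README §8(d): uses an L-value-free non-vanishing device: NO.
-/

namespace Summit.Ventures.HodgeRepro2.T5DVRQuotientCard

open Ideal

variable {𝒪 : Type*} [CommRing 𝒪] [IsDomain 𝒪] [IsDiscreteValuationRing 𝒪] {ϖ : 𝒪}

/-- The ideal `(ϖ)` generated by a uniformiser is prime. -/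
theorem isPrime_span (hϖ : Irreducible ϖ) : (span {ϖ}).IsPrime :=
  (span_singleton_prime hϖ.ne_zero).mpr hϖ.prime

omit [IsDomain 𝒪] [IsDiscreteValuationRing 𝒪] in
/-- The ideal `(ϖ)` generated by a uniformiser is non-zero. -/
theorem span_ne_bot (hϖ : Irreducible ϖ) : span {ϖ} ≠ ⊥ := by
  simpa [span_singleton_eq_bot] using hϖ.ne_zero

/-- `|𝒪/(ϖ^n)| = |𝒪/(ϖ)|^n` (as `Nat.card`; both sides are `0` when the residue field is
infinite): Mathlib's `cardQuot_pow_of_prime` for the prime `(ϖ)` of the Dedekind domain `𝒪`. -/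
theorem card_quot_span_pow (hϖ : Irreducible ϖ) (n : ℕ) :
    Nat.card (𝒪 ⧸ span {ϖ ^ n}) = Nat.card (𝒪 ⧸ span {ϖ}) ^ n := by
  haveI := isPrime_span hϖ
  have h := cardQuot_pow_of_prime (P := span {ϖ}) (span_ne_bot hϖ) (i := n)
  rwa [Submodule.cardQuot_apply, Submodule.cardQuot_apply, span_singleton_pow] at h

/-- A finite residue field `𝒪/(ϖ)` makes every quotient `𝒪/(ϖ^n)` finite. -/
theorem finite_quot_span_pow (hϖ : Irreducible ϖ) [Finite (𝒪 ⧸ span {ϖ})] (n : ℕ) :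
    Finite (𝒪 ⧸ span {ϖ ^ n}) := by
  apply Nat.finite_of_card_ne_zero
  rw [card_quot_span_pow hϖ n]
  exact pow_ne_zero _ Nat.card_pos.ne'

/-- The residue field `𝒪/𝔪` is `𝒪/(ϖ)` (`Irreducible.maximalIdeal_eq`). -/
noncomputable def residueFieldEquiv (hϖ : Irreducible ϖ) :
    IsLocalRing.ResidueField 𝒪 ≃+* 𝒪 ⧸ span {ϖ} :=
  Ideal.quotEquivOfEq hϖ.maximalIdeal_eq

/-- A finite residue field (Mathlib's `IsLocalRing.ResidueField`) makes `𝒪/(ϖ)` finite. -/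
theorem finite_quot_span_of_finite_residueField (hϖ : Irreducible ϖ)
    [Finite (IsLocalRing.ResidueField 𝒪)] : Finite (𝒪 ⧸ span {ϖ}) :=
  Finite.of_equiv _ (residueFieldEquiv hϖ).toEquiv

/-- A finite residue field makes every quotient `𝒪/(ϖ^n)` finite. -/
theorem finite_quot_span_pow_of_finite_residueField (hϖ : Irreducible ϖ)
    [Finite (IsLocalRing.ResidueField 𝒪)] (n : ℕ) : Finite (𝒪 ⧸ span {ϖ ^ n}) :=
  haveI := finite_quot_span_of_finite_residueField hϖ
  finite_quot_span_pow hϖ n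

/-- `|𝒪/(ϖ^n)| = |𝒪/𝔪|^n` with the residue field in Mathlib's spelling. -/
theorem card_quot_span_pow_eq_card_residueField_pow (hϖ : Irreducible ϖ) (n : ℕ) :
    Nat.card (𝒪 ⧸ span {ϖ ^ n}) = Nat.card (IsLocalRing.ResidueField 𝒪) ^ n := by
  rw [card_quot_span_pow hϖ n, Nat.card_congr (residueFieldEquiv hϖ).toEquiv]

section FiniteLocalRing

variable {m : ℕ}

/-- The ideal of non-units of `𝒪/(ϖ^{m+1})`: the image of `(ϖ)`. -/
def nonunitIdeal : Ideal (𝒪 ⧸ span {ϖ ^ (m + 1)}) :=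
  map (Ideal.Quotient.mk (span {ϖ ^ (m + 1)})) (span {ϖ})

omit [IsDomain 𝒪] [IsDiscreteValuationRing 𝒪] in
/-- `(ϖ^{m+1}) ⊆ (ϖ)`. -/
theorem span_pow_succ_le : span {ϖ ^ (m + 1)} ≤ (span {ϖ} : Ideal 𝒪) :=
  span_singleton_le_span_singleton.mpr ⟨ϖ ^ m, by ring⟩

omit [IsDomain 𝒪] [IsDiscreteValuationRing 𝒪] in
/-- The class of `x` lies in `nonunitIdeal` iff `ϖ ∣ x`. -/
theorem mk_mem_nonunitIdeal_iff (x : 𝒪) :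
    Ideal.Quotient.mk (span {ϖ ^ (m + 1)}) x ∈ nonunitIdeal (ϖ := ϖ) (m := m) ↔ ϖ ∣ x := by
  rw [nonunitIdeal, ← Ideal.mem_comap, comap_map_of_surjective _ Ideal.Quotient.mk_surjective,
    ← RingHom.ker_eq_comap_bot, mk_ker, sup_eq_left.mpr span_pow_succ_le, mem_span_singleton]

/-- On the finite local ring `𝒪/(ϖ^{m+1})` the non-units are exactly `nonunitIdeal`
(`T5DVRQuotientModel.isUnit_mk_iff`). -/
theorem not_isUnit_iff_mem (hϖ : Irreducible ϖ) (x : 𝒪 ⧸ span {ϖ ^ (m + 1)}) :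
    ¬ IsUnit x ↔ x ∈ nonunitIdeal (ϖ := ϖ) (m := m) := by
  obtain ⟨a, rfl⟩ := Ideal.Quotient.mk_surjective x
  rw [T5DVRQuotientModel.isUnit_mk_iff hϖ, not_not, mk_mem_nonunitIdeal_iff]

/-- `(𝒪/(ϖ^{m+1})) / nonunitIdeal ≃ 𝒪/(ϖ)` (the third isomorphism theorem). -/
noncomputable def quotNonunitIdealEquiv :
    ((𝒪 ⧸ span {ϖ ^ (m + 1)}) ⧸ nonunitIdeal (ϖ := ϖ) (m := m)) ≃+* 𝒪 ⧸ span {ϖ} := by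
  unfold nonunitIdeal
  exact DoubleQuot.quotQuotEquivQuotOfLE span_pow_succ_le

omit [IsDomain 𝒪] [IsDiscreteValuationRing 𝒪] in
/-- `|(𝒪/(ϖ^{m+1})) / nonunitIdeal| = q`. -/
theorem card_quot_nonunitIdeal :
    Nat.card ((𝒪 ⧸ span {ϖ ^ (m + 1)}) ⧸ nonunitIdeal (ϖ := ϖ) (m := m)) =
      Nat.card (𝒪 ⧸ span {ϖ}) :=
  Nat.card_congr (quotNonunitIdealEquiv (ϖ := ϖ) (m := m)).toEquiv

/-- `|nonunitIdeal| = q^m`: the non-units of `𝒪/(ϖ^{m+1})` number `q^m`. -/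
theorem card_nonunitIdeal (hϖ : Irreducible ϖ) [Finite (𝒪 ⧸ span {ϖ})] :
    Nat.card (nonunitIdeal (ϖ := ϖ) (m := m)) = Nat.card (𝒪 ⧸ span {ϖ}) ^ m := by
  have h := Submodule.card_eq_card_quotient_mul_card (nonunitIdeal (ϖ := ϖ) (m := m))
  rw [card_quot_span_pow hϖ, card_quot_nonunitIdeal, pow_succ] at h
  exact (Nat.eq_of_mul_eq_mul_right Nat.card_pos h).symm

/-- The units of a monoid, as the subtype of elements that are units. -/
noncomputable def unitsEquivSubtype (M : Type*) [Monoid M] : Mˣ ≃ {x : M // IsUnit x} where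
  toFun u := ⟨u, u.isUnit⟩
  invFun x := x.2.unit
  left_inv u := Units.ext u.isUnit.unit_spec
  right_inv x := Subtype.ext x.2.unit_spec

/-- `|(𝒪/(ϖ^{m+1}))ˣ| = q^m (q − 1)`: the index `[𝒪^× : 1 + 𝔭^{m+1}]` of §AA.1(iii). -/
theorem card_units (hϖ : Irreducible ϖ) [Finite (𝒪 ⧸ span {ϖ})] :
    Nat.card (𝒪 ⧸ span {ϖ ^ (m + 1)})ˣ =
      Nat.card (𝒪 ⧸ span {ϖ}) ^ m * (Nat.card (𝒪 ⧸ span {ϖ}) - 1) := by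
  haveI : Finite (𝒪 ⧸ span {ϖ ^ (m + 1)}) := finite_quot_span_pow hϖ (m + 1)
  letI := Fintype.ofFinite (𝒪 ⧸ span {ϖ ^ (m + 1)})
  classical
  have hU : Nat.card (𝒪 ⧸ span {ϖ ^ (m + 1)})ˣ =
      Fintype.card {x : 𝒪 ⧸ span {ϖ ^ (m + 1)} // IsUnit x} := by
    rw [Nat.card_congr (unitsEquivSubtype _), Nat.card_eq_fintype_card]
  have hN : Fintype.card {x : 𝒪 ⧸ span {ϖ ^ (m + 1)} // ¬ IsUnit x} =
      Nat.card (𝒪 ⧸ span {ϖ}) ^ m := by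
    rw [← Nat.card_eq_fintype_card,
      Nat.card_congr (Equiv.subtypeEquivRight fun x => not_isUnit_iff_mem hϖ x),
      card_nonunitIdeal hϖ]
  have hC : Fintype.card {x : 𝒪 ⧸ span {ϖ ^ (m + 1)} // ¬ IsUnit x} =
      Fintype.card (𝒪 ⧸ span {ϖ ^ (m + 1)}) -
        Fintype.card {x : 𝒪 ⧸ span {ϖ ^ (m + 1)} // IsUnit x} :=
    Fintype.card_subtype_compl _
  have hT : Fintype.card (𝒪 ⧸ span {ϖ ^ (m + 1)}) = Nat.card (𝒪 ⧸ span {ϖ}) ^ (m + 1) := by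
    rw [← Nat.card_eq_fintype_card, card_quot_span_pow hϖ]
  have hle : Fintype.card {x : 𝒪 ⧸ span {ϖ ^ (m + 1)} // IsUnit x} ≤
      Fintype.card (𝒪 ⧸ span {ϖ ^ (m + 1)}) := Fintype.card_subtype_le _
  rw [hU, Nat.mul_sub_one, ← pow_succ]
  omega

/-- The same count with the residue field in Mathlib's spelling. -/
theorem card_units_eq_card_residueField (hϖ : Irreducible ϖ)
    [Finite (IsLocalRing.ResidueField 𝒪)] :
    Nat.card (𝒪 ⧸ span {ϖ ^ (m + 1)})ˣ =
      Nat.card (IsLocalRing.ResidueField 𝒪) ^ m * (Nat.card (IsLocalRing.ResidueField 𝒪) - 1) := by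
  haveI := finite_quot_span_of_finite_residueField hϖ
  rw [card_units hϖ, Nat.card_congr (residueFieldEquiv hϖ).toEquiv]

end FiniteLocalRing

end Summit.Ventures.HodgeRepro2.T5DVRQuotientCard
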